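import Mathlib.Tactic.Linarith
import Mathlib.Tactic.LinearCombination
import Mathlib.Tactic.Ring
import Mathlib.Tactic.NormNum
import HarnessLib

/-!
# The (0,1) cell of the ι-window, EXISTENCE side, IV: the glued-tangency census `(β)′` and the `U₂`-hull vertex row

Family `hodge`, layer `Literature/AlgebraicGeometry/HodgeTheory`. Companion to `SemiregularityIotaWindowExistenceSide.lean` (pv3-g8),
`SemiregularityQuotDimensionSieve.lean` (pv3-g9), `SemiregularityStructureCount.lean` (pv3-g10) and `SemiregularityQuotSieveFixedNode.lean`
(pv1-g16), with the SAME dictionary: `X = J = J(C)`, `C` general of genus 4, `ι = −1`, a would-be `(0,1)` object `F = ker(E ↠ T)` of shape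
(4.5)(a) with flat rank-2 hull `E`, `T₀ ⊂ T` its 0-dimensional torsion of length `t`, `F' := ker(E ↠ T/T₀)` canonical, `M := F'_x` at an
`ι`-fixed point `x`, `Q = Quot^ι_x(M; n₊, n₋)` the punctual `ι`-Quot scheme; (QD): `dim_{[F]} Q ≥ 2` kills `F` ((8.3.3)-free, certified R288).
Ladder note `papers/HodgeConjecture/hodge-weil-ladder` (packet `run/shared/lean/b2b/hodge-weil/`), CLAIM TABLE v26/v27 (LADDER C174/C180) row
pv3-g11, report `b2b-hweil-pv3-g11/H2-EXISTENCE-SIDE-4.md`, scripts `code/pv3-g11/`. Def-free, fully proved ELEMENTARY statements (integer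
bookkeeping and polynomial identities); the module theory and geometry are in the docstrings and the report. HONEST FRAMING: census / negative
results about the existence side of one cell of the ladder's H2 test; no case of the Hodge conjecture is proved; nothing here is a rung; no
statement of [Markman 2025] is used; NOTHING here depends on the local Poisson-liftability criterion (LP), on 'ker ob = ann(ch)', on a transport of
supports, or on the theta function.

(I) `(β)′` (report §§1–4): the excess stratum of the glued supports `S_b = (W₂ + a) ∪ (−W₂ − a) = Θ_b ∩ Θ_{−b}` (`2b = c − c′`) at parameters where
`S_b` passes through a 2-torsion point `x` of `J`. There `x` lies on the excess curve `Γ = Y₁ ∩ Y₂`, the two branches are tangent, and in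
`ι`-odd coordinates `I(Y₁) = (x₄, m′ − G)`, `I(Y₂) = (x₄, m′ + G)` with `G(u)` even and square-free (generically `G = u₁u₂`, a node with `ι`-stable
branches). With the value matrix `Φ = [[s,t],[t^ι,s^ι]]` of `E → N₁ ⊕ N₂` and `D := ss^ι − tt^ι`, the gluing sheaf `R` has generic rank `ρ = 1` on `Γ`
iff `D|_Γ ≡ 0`; mixed rank is excluded (`betaPrime_mixedRank_excluded`: `n₁·h = 4 + 2(ρ′+ρ″)` must be `≡ 0 mod 4`); the torsion budget is
`t ≤ 7` in all cases (`betaPrime_torsion_budget`), the `x`-part of `T₀` is balanced `(n,n)` because every hull type has signed Betti sum `0`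
(`betaPrime_signedBetti`), so `n ≤ 3`. The hull `F'_x` is of type I (`rank Φ(x) = 2`, `≅ I₁ ⊕ I₂`, `(m₊,m₋) = (2,2)`), II (`rank 1, ρ = 0`:
`M_β`, `(3,2)`, relations `R₁..R₄`), III (`rank 1, ρ = 1`: `≅ M⁰ = (x₄,q)e_u ⊕ Ae_v` — pv1-g16's THEOREM B⁰ verbatim), IV-0 (`rank 0, ρ = 0`:
`x₄E + qE + Aκ₁ + Aκ₂`, `(3,3)`, six relations), IV-1 (`rank 0, ρ = 1`, simple base point: ONE module up to `ι`-isomorphism, `(2,2)`), or the square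
type (`(s₁,s₂) = (s_p², s_q²)`: `≅ M_𝔞`, pv1-g16's THEOREM B verbatim). The census is pv3-g10's free-module reduction
(`freeModule_reduction_forms`) plus three structure counts; every cell is `≥ 2` (`betaPrime_typeI_counts`, `betaPrime_typeII_counts`,
`betaPrime_typeIV0_counts`, `betaPrime_chunk11`). THEOREM (β)′: `(β)′` carries no `(0,1)` object — (8.3.3)-free, transport-free — up to one flagged
sub-configuration `(β)‴` of expected negative dimension.

(II) THE `U₂`-HULL VERTEX ROW (report §5): `E = U₂(e)`, `e = [a w⁻² + b w⁻¹] ∈ ℙ(K_{2x})`, `D = 2x`, `S = C − C`. The vertex module is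
`M_U = {(u,v) : ū = −r₀ v̄}` with `r₀ = ∫_z^y η_P` for the differential of the second kind with principal part `d(aw⁻² + bw⁻¹)`; the image `G` of
`U₂` in `N = α_*(A ⊠ A)` contains `𝒪_S·g_s` with `G/𝒪_S g_s ≅ 𝒪_{Z̄} ⊗ k₋`, `Z̄ = 2B₁ + 2B₂` (`B₁ = C − x`, `B₂ = x − C`), so by Riemann–Roch on
`C × C` (`u2_riemannRoch_CxC`) and the formal-function lengths of `R¹α_*` (`u2_R1_lengths`), `χ(G(m)) = 12m² − 8m − 5 − h`,
`h = h¹(4x) ∈ {0,1}`: **`t = 5 + h` exactly** (`u2_torsion_length`); the class `[w⁻¹]` gives the linear coefficient `−16 ≠ −8` — impossible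
(`u2_simplePole_void`); `t₀(G) = 16` forces the vertex signs `(2,3)` at a non-Weierstrass `x` (`u2_signs`: the K-polynomial of
`gr(A/𝔍̃) = S/I(ξ₄)` at `−1` is `−16`; at a Weierstrass point it is `0` and the signs are balanced). For `x` non-Weierstrass the v-shadow
`𝔍 = (R : r₀) = 𝔭₁^{(2)} ∩ 𝔭₂^{(2)}` has `gr_n 𝔍 = H⁰(nK − 4x)`, `in(𝔍̃) = I(ξ₄)` for the fourth-order jet `ξ₄` of `C` at `x`, which spans
`ℙ³` and is therefore 2-regular: six quadrics with the 2-linear resolution `0 → S(−4)³ → S(−3)⁸ → S(−2)⁶` (`xi4_betti_bookkeeping` — the SAME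
table as `J2_betti_bookkeeping` of the swap row), whence `M_U` has `(m₊,m₋) = (1,7)`, eight lifted linear relations of sign `+` and `κ` — the
presentation shape THEOREM E1's census (R316) consumed — and the `(2,3)`-cells of that census apply verbatim; at a (simple) Weierstrass point
`in(𝔍̃) = I(4x)` is a complete intersection `(1,2,2)` (`u2_weierstrass_ci`) and THEOREM E1′'s census (R323) applies verbatim. THEOREM E1-U: the
`U₂` row carries no `(0,1)` object at any `x` and any `e`; with THEOREMS E1/E1′/E1″ and N55-1/N55-2: `R_vtx` is VOID; `(E1)` is EMPTY.

What is NOT here: the module-theoretic proofs (report §§1–5); anything about objects; any (LP) statement. 0 unconditional rungs above the floor.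
-/

namespace Literature.AlgebraicGeometry.HodgeTheory

section H2GluedTangencyCensus

/-- Mixed gluing rank on a reducible excess curve is numerically excluded (report 1.1): the `m`-linear term of pv3-g8's class extraction
reads `n₁·h = 4 + 2(ρ′ + ρ″)`; for `(ρ′,ρ″) = (1,0)` this is `6`, but `n₁·h = 4α + 8β` is divisible by `4`. [folklore] -/
theorem betaPrime_mixedRank_excluded : ∀ α β : ℤ, 4 * α + 8 * β ≠ 6 := by
  intro α β h
  omega

/-- The torsion budget of `(β)′` (report 2.4): for `ρ = 1` the required `χ_R = t − 6, t − 10, t − 8` (hull classes `6x − 2d`, `4x − d`,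
`2x`) is at most `n₁·Γ − 8 = −4, −3, −2` (pv3-g8 5.2 with `c = 0`), giving `t ≤ 2, 7, 6`; for `ρ = 0` the length of the finite gluing sheaf is
at most `2·n₁·Γ + ℓ_Γ`, i.e. `2·3 + 1 = 7` (`n₁ = x`) and `2·2 + 0 = 4` (`n₁ = 3x − d`); so `t ≤ 7` always and a balanced `x`-part `(n,n)` has
`n ≤ 3`. [folklore] -/
theorem betaPrime_torsion_budget :
    (∀ t : ℤ, t - 6 ≤ -4 → t ≤ 2) ∧ (∀ t : ℤ, t - 10 ≤ -3 → t ≤ 7) ∧ (∀ t : ℤ, t - 8 ≤ -2 → t ≤ 6) ∧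
    (2 * 3 + 1 = 7 ∧ 2 * 2 + 0 = 4) ∧ (∀ n : ℕ, 2 * n ≤ 7 → n ≤ 3) := by
  refine ⟨?_, ?_, ?_, ⟨by norm_num, by norm_num⟩, ?_⟩
  · intro t h; omega
  · intro t h; omega
  · intro t h; omega
  · intro n h; omega

/-- Signed Betti sums `Σ_i (−1)^i (β_i⁺ − β_i⁻)` of the local hull types of `(β)′` (report 2.5) — all zero, so the `x`-part of the
torsion is balanced: type I / IV-1 (`(2,2)` generators, `(1,1)` relations), type III = `M⁰` (`(1,2)`, one `−` relation), type II = `M_β`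
(`(3,2)`, relations `(2,2)`, one second syzygy of sign `−`), type IV-0 (`(3,3)`, `(3,3)`, `(1,1)`). [folklore] -/
theorem betaPrime_signedBetti :
    ((2 : ℤ) - 2) - (1 - 1) = 0 ∧ ((1 : ℤ) - 2) - (0 - 1) = 0 ∧
    ((3 : ℤ) - 2) - (2 - 2) + (0 - 1) = 0 ∧ ((3 : ℤ) - 3) - (3 - 3) + (1 - 1) = 0 := by
  norm_num

/-- The free-module reduction bound `(m₊ − μ₊)n + (m₋ − μ₋)n − E` (pv3-g10 8.5 (v), certified R323) rewritten for the three generator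
profiles used in the `(β)′` census, with `μ₊ = n − d`, `μ₋ = n − e` and `E ≤ d + e`, `2d + 2e`, `3d + 3e` respectively (report 4.1–4.3). [folklore] -/
theorem freeModule_reduction_forms (n d e : ℤ) :
    (2 - (n - d)) * n + (2 - (n - e)) * n - (d + e) = n * (4 - 2 * n) + (n - 1) * (d + e) ∧
    (3 - (n - d)) * n + (2 - (n - e)) * n - (2 * d + 2 * e) = n * (5 - 2 * n) + (n - 2) * (d + e) ∧
    (3 - (n - d)) * n + (3 - (n - e)) * n - (3 * d + 3 * e) = n * (6 - 2 * n) + (n - 3) * (d + e) := by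
  refine ⟨by ring, by ring, by ring⟩

/-- Types I and IV-1 (`(m₊,m₋) = (2,2)`, `E ≤ d + e`; report 4.1): `n = 1`: cell `(0,0)` gives `0 + 2 = 2`, the cyclic cells `3 + 2 = 5`;
`n = 2`: the point `F = 𝔪M` has `μ₊(𝔪M) ≥ 4·2 − 1 = 7`, the other cells `≥ 3 + (d + e) ≥ 4`; `n = 3`: cells with `d + e ≥ 3` give
`3 − 6 + 2(d + e) ≥ 3`, and the cell `(d,e) = (1,1)` is a structure count — components of dimension `16` and `14 = (4 + 2 − 1) + (1 + 8)`,
Hom unknowns `2·3 + 2·3 = 12`, gauge `7 + 7 = 14`, at most `2` equations: `14 + 12 − 2 − 14 = 10`. [folklore] -/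
theorem betaPrime_typeI_counts :
    (0 + 2 = 2 ∧ 3 + 2 = 5 ∧ 4 * 2 - 1 = 7) ∧
    (∀ d e : ℕ, 1 ≤ d + e → 3 + (d + e) ≥ 4) ∧
    (∀ d e : ℤ, 3 ≤ d + e → 3 - 6 + 2 * (d + e) ≥ 3) ∧
    (8 + 8 = 16 ∧ (4 + 2 - 1) + (1 + 8) = 14 ∧ 2 * 3 + 2 * 3 = 12 ∧ 7 + 7 = 14 ∧ 14 + 12 - 2 - 14 = 10) := by
  refine ⟨by norm_num, ?_, ?_, by norm_num⟩
  · intro d e h; omega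
  · intro d e h; omega

/-- Type II (`M_β`, `(m₊,m₋) = (3,2)`, `E ≤ 2d + 2e`; report 4.2): `n = 1`: `0 + 3 = 3`, cyclic cells `3 + 3 − 1 = 5`; `n = 2`: the `(0,0)`
cell has `dim_U = 8 − 8 = 0` and bound `(3 − 2)·2 = 2`, the others `≥ 3 + 2 = 5`; `n = 3`: `e ≥ 1`, cells with `d + e ≥ 2` give
`3 − 3 + (d + e) ≥ 2`, and the cell `(0,1)` is a structure count: structures `12`, Hom unknowns `3·3 + 2·3 = 15`, gauge `9 + 7 = 16`, two
equations: `12 + 15 − 2 − 16 = 9`. [folklore] -/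
theorem betaPrime_typeII_counts :
    (0 + 3 = 3 ∧ 3 + 3 - 1 = 5) ∧ (8 - 8 = 0 ∧ (3 - 2) * 2 = 2 ∧ 3 + 2 = 5) ∧
    (∀ d e : ℕ, 2 ≤ d + e → 3 - 3 + (d + e) ≥ 2) ∧
    (3 * 4 = 12 ∧ 3 * 3 + 2 * 3 = 15 ∧ 9 + 7 = 16 ∧ 12 + 15 - 2 - 16 = 9) := by
  refine ⟨by norm_num, by norm_num, ?_, by norm_num⟩
  intro d e h; omega

/-- Type IV-0 (`(m₊,m₋) = (3,3)`, `E ≤ 3d + 3e`; report 4.3): `n = 1`: `2 + 2 = 4`, other cells `3 + 4 − 2(d + e) ≥ 3` for `d + e ≤ 2`;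
`n = 2`: `(0,0)` gives `4`, other cells `3 + 4 − (d + e) ≥ 3` for `d + e ≤ 4`; `n = 3`: `F = 𝔪M` has `μ₊(𝔪M) ≥ 4·3 − 3 = 9`, other cells
`3`. [folklore] -/
theorem betaPrime_typeIV0_counts :
    (2 + 2 = 4) ∧ (∀ d e : ℤ, 0 ≤ d + e → d + e ≤ 2 → 3 + 4 - 2 * (d + e) ≥ 3) ∧
    (∀ d e : ℤ, 0 ≤ d + e → d + e ≤ 4 → 3 + 4 - (d + e) ≥ 3) ∧ (4 * 3 - 3 = 9 ∧ 3 + 0 + 0 = 3) := by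
  refine ⟨by norm_num, ?_, ?_, by norm_num⟩
  · intro d e h0 h; omega
  · intro d e h0 h; omega

/-- Off-support chunks when the fixed point carries no torsion (report 4.5): a single `(1,1)` chunk in a free germ `E_z` has local dimension
`≥ μ₊(𝔪E_z) = 4` at `F = 𝔪E_z` and `≥ 3` (the `GL₄`-orbit of a hyperplane `W ⊂ 𝔪/𝔪²`, `dim ℙ³ = 3`) at the cyclic points; single `(2,2)`,
`(3,3)` chunks are `≥ 2` by N55-2; all are `≥ 2`. [folklore] -/
theorem betaPrime_chunk11 : (4 : ℕ) ≥ 2 ∧ (3 : ℕ) ≥ 2 ∧ 4 - 1 = 3 := by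
  norm_num

/-- Riemann–Roch on `C × C` for `C` of genus 4 (report 5.2): `χ(𝒪(p(f₁ + f₂) + rΔ)) = χ(𝒪_{C×C}) + (L² − L·K)/2` with `χ(𝒪) = 9`,
`f₁f₂ = f_iΔ = 1`, `Δ² = −6`, `K = 6f₁ + 6f₂`, i.e. `9 + p² + 2pr − 3r² − 6p − 6r`; and `α^*θ ≡ 3f₁ + 3f₂ + Δ`. Evaluations used:
`A⁻¹ ⊠ A⁻¹ (m)` (`p = 3m − 2`): `12m² − 40m + 25`; `𝒪(m)` (`p = 3m`): `12m² − 24m + 9`; `A ⊠ A (m)` (`p = 3m + 2`): `12m² − 8m + 1`;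
`𝒪(−x) ⊠ 𝒪(−x) (m)` (`p = 3m − 1`): `12m² − 32m + 16` (here `A = 𝒪(2x)`, `r = m`). [folklore] -/
theorem u2_riemannRoch_CxC (m : ℤ) :
    9 + (3 * m - 2) ^ 2 + 2 * (3 * m - 2) * m - 3 * m ^ 2 - 6 * (3 * m - 2) - 6 * m = 12 * m ^ 2 - 40 * m + 25 ∧
    9 + (3 * m) ^ 2 + 2 * (3 * m) * m - 3 * m ^ 2 - 6 * (3 * m) - 6 * m = 12 * m ^ 2 - 24 * m + 9 ∧
    9 + (3 * m + 2) ^ 2 + 2 * (3 * m + 2) * m - 3 * m ^ 2 - 6 * (3 * m + 2) - 6 * m = 12 * m ^ 2 - 8 * m + 1 ∧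
    9 + (3 * m - 1) ^ 2 + 2 * (3 * m - 1) * m - 3 * m ^ 2 - 6 * (3 * m - 1) - 6 * m = 12 * m ^ 2 - 32 * m + 16 := by
  refine ⟨by ring, by ring, by ring, by ring⟩

/-- The `R¹α_*` lengths at the vertex of `C − C` by formal functions along the diagonal (C112 (C-ii); pv3-g8 4.2 computed the first line
for the swap hull with the same degrees): for `A = 𝒪(2x)`, `len R¹α_*(A⁻¹ ⊠ A⁻¹) = h¹(𝒪(−4x)) + h¹(K(−4x)) + 0 = 7 + (1 + h)` with
`h = h¹(4x) = h⁰(K − 4x) ∈ {0,1}`; `len R¹α_*(𝒪(−x) ⊠ 𝒪(−x)) = h¹(𝒪(−2x)) + h¹(K(−2x)) = 5 + 1`; `len R¹α_*𝒪 = 4 + 1`;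
`len R¹α_*(A ⊠ A) = h`. (Degrees on a genus-4 curve: `h¹` of a degree-`d` non-special-dual bundle is `−d + 3`.) [folklore] -/
theorem u2_R1_lengths (h : ℤ) : 7 + (1 + h) + 0 = 8 + h ∧ (4 : ℤ) + 3 = 7 ∧ (2 : ℤ) + 3 = 5 ∧ 5 + 1 = 6 ∧ 4 + 1 = 5 := by
  refine ⟨by ring, by norm_num, by norm_num, by norm_num, by norm_num⟩

/-- **`t = 5 + h` for the `U₂`-hull vertex row** (report 5.2). The image `G` of `U₂` in `N` satisfies `G ⊃ 𝒪_S·g_s`,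
`G/𝒪_S g_s ≅ 𝒪_{Z̄}`, `Z̄ = 2B₁ + 2B₂`, so `χ(G(m)) = 2χ(𝒪_S(m)) − χ(𝒪_S(−Z̄)(m))` with `χ(𝒪_S(m)) = 12m² − 24m + 14` and
`χ(𝒪_S(−Z̄)(m)) = (12m² − 40m + 25) + (8 + h)`; the target `χ(T(m)) = 12m² − 8m` and `χ(T) = χ(G) + t` give `t = 5 + h`. Second line: the
same with the simple-pole class `[w⁻¹]` (`Z̄′ = B₁ + B₂`): `χ(G(m)) = 12m² − 16m + 6`, whose `m`-linear coefficient is not `−8`. Third line: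
the consistency check `χ(N) = (12m² − 8m + 1) + h` at `m = 0` equals C114's required colength `1 + h`. [folklore] -/
theorem u2_torsion_length (m h : ℤ) :
    2 * (12 * m ^ 2 - 24 * m + 14) - (12 * m ^ 2 - 40 * m + 25 + (8 + h)) = 12 * m ^ 2 - 8 * m - 5 - h ∧
    2 * (12 * m ^ 2 - 24 * m + 14) - (12 * m ^ 2 - 32 * m + 16 + 6) = 12 * m ^ 2 - 16 * m + 6 ∧
    (12 * (0 : ℤ) ^ 2 - 8 * 0 + 1) + h = 1 + h := by
  refine ⟨by ring, by ring, by ring⟩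

/-- The class `[w⁻¹]` is numerically void (report 5.2 (iii)): `χ(T(m)) = 12m² − 8m` cannot equal `(12m² − 16m + 6) + t` for any constant
`t`, since the `m`-linear coefficients differ. [folklore] -/
theorem u2_simplePole_void : ¬ ∃ t : ℤ, ∀ m : ℤ, 12 * m ^ 2 - 8 * m = (12 * m ^ 2 - 16 * m + 6) + t := by
  rintro ⟨t, ht⟩
  have h0 := ht 0
  have h1 := ht 1
  omega

/-- Signs at the vertex (report 5.3): `t₀` of a module is the K-polynomial of its associated graded at `z = −1`. Checks: `k₊`:
`(1 − z)⁴ ↦ 16`; `A/𝔪²`: `(1 + 4z)(1 − z)⁴ ↦ −48 = 16 − 4·16`; `R = gr(C − C)` (complete intersection `(2,3)`): `(1 − z²)(1 − z³) ↦ 0`.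
For the v-shadow of the `U₂` row: `x` non-Weierstrass, `H = (1,4,4,…)`, K-polynomial `(1 + 3z)(1 − z)³ ↦ −16`, so `t₀(G) = 0 + (−1)(−16) = 16`,
`t₀(T₀) = −16`, and with `t = 5` the vertex signs are `(2,3)`; `x` Weierstrass, `H = (1,3,4,4,…)`, K-polynomial `(1 + z)²(1 − z)³ ↦ 0`:
balanced. [folklore] -/
theorem u2_signs :
    (1 - (-1 : ℤ)) ^ 4 = 16 ∧ (1 + 4 * (-1 : ℤ)) * (1 - (-1)) ^ 4 = -48 ∧ (16 : ℤ) - 4 * 16 = -48 ∧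
    (1 - (-1 : ℤ) ^ 2) * (1 - (-1) ^ 3) = 0 ∧
    (1 + 3 * (-1 : ℤ)) * (1 - (-1)) ^ 3 = -16 ∧ (0 : ℤ) + (-1) * (-16) = 16 ∧
    (1 + (-1 : ℤ)) ^ 2 * (1 - (-1)) ^ 3 = 0 ∧
    (∀ a b : ℕ, a + b = 5 → (b : ℤ) - a = 1 → a = 2 ∧ b = 3) := by
  refine ⟨by norm_num, by norm_num, by norm_num, by norm_num, by norm_num, by norm_num, by norm_num, ?_⟩
  intro a b h1 h2
  omega

/-- The fourth-order jet `ξ₄` of the canonical curve at a non-Weierstrass point spans `ℙ³`, so `I(ξ₄)` is 2-regular with Hilbert function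
`(1,4,4,4,…)` of `S/I(ξ₄)` (report 5.4): K-polynomial `(1 + 3z)(1 − z)³ = 1 − 6z² + 8z³ − 3z⁴`, i.e. Betti numbers `(6, 8, 3)` read degree
by degree: `10 − 4 = 6` quadrics, `4·6 − (20 − 4) = 8` linear syzygies, and in degree 4: `6·10 − 8·4 + 3 = 35 − 4`. (The same table as
`J2_betti_bookkeeping` of `SemiregularityStructureCount.lean` for the swap row's `J₂`.) [folklore] -/
theorem xi4_betti_bookkeeping (z : ℤ) :
    (1 + 3 * z) * (1 - z) ^ 3 = 1 - 6 * z ^ 2 + 8 * z ^ 3 - 3 * z ^ 4 ∧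
    (10 - 4 = 6 ∧ 4 * 6 - (20 - 4) = 8 ∧ 6 * 10 - 8 * 4 + 3 = 35 - 4) := by
  refine ⟨by ring, by norm_num⟩

/-- At a simple Weierstrass point `in(𝔍̃) = I(4x) = (z_W, c², b² − 2ac + (2ν/3)bc)` is a complete intersection of type `(1,2,2)` (report
5.3′): Hilbert series `(1 + z)²/(1 − z)`, i.e. `(1 + z)² = (1 − z)·(1 + 3z + 4z² + 4z³ + …)` truncated: `(1 + z)² − (1 − z)(1 + 3z) = 4z²` and the
K-polynomial `(1 − z)(1 − z²)² = (1 + z)²(1 − z)³`; the six quadratic monomials in `(a,b,c)` map onto `k[τ]/τ⁴` (`a² ↦ 1`, `ab ↦ τ`, `b², ac ↦ τ²`,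
`bc ↦ τ³/2`, `c² ↦ 0`) with a 2-dimensional kernel: `6 − 4 = 2`. [folklore] -/
theorem u2_weierstrass_ci (z : ℤ) :
    (1 + z) ^ 2 - (1 - z) * (1 + 3 * z) = 4 * z ^ 2 ∧ (1 - z) * (1 - z ^ 2) ^ 2 = (1 + z) ^ 2 * (1 - z) ^ 3 ∧ (6 - 4 = 2) := by
  refine ⟨by ring, by ring, by norm_num⟩

end H2GluedTangencyCensus

end Literature.AlgebraicGeometry.HodgeTheory
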